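/-
Origin: expansion seat `planner-pub-hodgecm-toy-g2-0`, handover #10 2026-08-18T07:15:28Z (`HOME/pub-hodgecm-toy-g2/lean/ToyG2/Axioms2.lean`, md5 f49b2f45, 228 lines);
landed by the gen-7 packager in gate run 25 as `HodgeCM/Model/ToyG2/Axioms2.lean` (import ^import ToyG2\.→import HodgeCM.Model.ToyG2. ×1).
-/
/-
Copyright (c) 2026. All rights reserved.
Released under Apache 2.0 license as described in the file LICENSE.
-/
import Mathlib
import Summits.HodgeConjecture.HodgeCM.Model.ToyG2.Universe2
import Summits.HodgeConjecture.HodgeCM.Model.Toy.ToyTrTop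

/-!
# ToyG2.Axioms2 — M27 and M28 in the generation-2 universe; 27 of the 28 model axioms

* `map_top_dμ` : on the top exterior power `⋀^{4[K:ℚ]} H¹(A_{Φ₀} × ⋯ × A_{Φ₃})` the diagonal multiplication
  by `a ∈ K` is the scalar `N_{K/ℚ}(a)⁴` (eigenbasis computation; the product of all eigenvalues is
  `∏_τ τ(a)` per atom, gen-1 `prod_ev`).
* `fact_deg_diag` : **M27 `Fact_deg_diag` holds in `toyModel2With D T pl` for EVERY trace system `T`**:
  off the top degree both sides vanish (`TraceSys.degree`), in the top degree by `map_top_dμ`.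
* `algDuality_PP`, `fact_algDuality` : **M28 `Fact_algDuality` holds in `toyModel2With exteriorHodgeData T pl`**:
  the gen-1 twisted trace-form star `DQ` (which is generic in the degree) at the gen-2 dimension
  `dim (A⁴) = 4 · ([K:ℚ]/2) = 2[K:ℚ]` (`finrank_eq_k₂`).
* `toyModel2_axioms_of'` : hence **27 of the 28 fields of `ModelAxioms` hold in
  `toyModel2With exteriorHodgeData T pl` for every trace system `T` and block assignment `pl`**; the one
  displayed hypothesis is M26 `Fact_gysin_surface` (DESIGN.md §7, GYSIN STRATEGY);
  `toyModel2_zero_modelAxioms` : with zero traces all 28 hold (a second model of `ModelAxioms`, on the new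
  object layer).
-/

namespace HodgeCM.ToyG2

open HodgeCM.Toy HodgeCM.Toy.CMPresentation
open Literature.AlgebraicGeometry.Motives
open Literature.AlgebraicGeometry.Motives.HodgeStructure (EndAction conj ofRat mem_hodgeClasses_iff)
open Literature.AlgebraicGeometry.ShimuraVarieties (conjRingHomK)
open scoped TensorProduct
open exteriorPower Obj₂

noncomputable section

/-! ### The top exterior power of the diagonal multiplication (gen-1 objects) -/

/-- complexification commutes with `Θ` and `⋀^k` -/
lemma theta_tmul_map (X : Obj) (n : ℕ) (f : X.L →ₗ[ℚ] X.L) (w : ⋀[ℚ]^n X.L) :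
    X.Θ n ((1 : ℂ) ⊗ₜ[ℚ] map n f w) = map n (f.baseChange ℂ) (X.Θ n ((1 : ℂ) ⊗ₜ[ℚ] w)) := by
  rw [← LinearMap.baseChange_tmul]
  exact BC.theta_naturality ℚ ℂ X.L n f _

/-- (Ported verbatim from the HodgeCMPerL package; no docstring in the source.) -/
lemma one_tmul_smul_rat {V : Type*} [AddCommGroup V] [Module ℚ V] (q : ℚ) (v : V) :
    (1 : ℂ) ⊗ₜ[ℚ] (q • v) = (q : ℂ) • ((1 : ℂ) ⊗ₜ[ℚ] v) := by
  rw [← TensorProduct.smul_tmul, Rat.smul_one_eq_cast, TensorProduct.smul_tmul', smul_eq_mul, mul_one]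

/-- a rational linear map is determined by its complexification read through `Θ` -/
lemma eq_of_theta (X : Obj) (k : ℕ) {f g : ⋀[ℚ]^k X.L →ₗ[ℚ] ⋀[ℚ]^k X.L}
    (h : ∀ y, X.Θ k ((1 : ℂ) ⊗ₜ[ℚ] f y) = X.Θ k ((1 : ℂ) ⊗ₜ[ℚ] g y)) : f = g := by
  apply LinearMap.ext
  intro y
  have h1 := (X.Θ k).injective (h y)
  exact ofRat_injective h1

/-- `⋀^{top}` of the complexified diagonal multiplication by `a` is the scalar `N(a)⁴` -/
theorem map_top_dμC (K : CMField) (Φ : Fin 4 → CMType K) (a : K) {k : ℕ}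
    (hk : Fintype.card (PP K Φ).Idx = k) :
    map k ((dμ K Φ a).baseChange ℂ)
      = ((((Algebra.norm ℚ a) ^ 4 : ℚ) : ℂ)) • (LinearMap.id : _ →ₗ[ℂ] ⋀[ℂ]^k (PP K Φ).LC) := by
  refine ((PP K Φ).eB.exteriorPower k).ext fun S => ?_
  rw [LinearMap.smul_apply, LinearMap.id_apply, basis_eq_mono (PP K Φ) S, map_dμC_mono]
  congr 1
  have hbij : Function.Bijective (enum (PP K Φ) S) := by
    refine (Fintype.bijective_iff_injective_and_card _).mpr ⟨enum_injective (PP K Φ) S, ?_⟩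
    rw [Fintype.card_fin, hk]
  rw [hbij.prod_comp (ev K Φ a), prod_ev]
  push_cast
  rfl

/-- **`⋀^{top}` of the diagonal multiplication by `a ∈ K` on `H¹(A⁴)` is the scalar `N_{K/ℚ}(a)⁴`.** -/
theorem map_top_dμ (K : CMField) (Φ : Fin 4 → CMType K) (a : K) {k : ℕ}
    (hk : Fintype.card (PP K Φ).Idx = k) :
    map k (dμ K Φ a) = ((Algebra.norm ℚ a) ^ 4) • LinearMap.id := by
  apply eq_of_theta (PP K Φ) k
  intro y
  rw [theta_tmul_map (PP K Φ) k (dμ K Φ a) y]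
  rw [map_top_dμC K Φ a hk]
  rw [LinearMap.smul_apply, LinearMap.id_apply, LinearMap.smul_apply, LinearMap.id_apply]
  rw [one_tmul_smul_rat]
  rw [LinearEquiv.map_smul]

/-! ### Transfer of diagonal actions; numerology of the gen-2 dimension -/

variable (D : HodgeData) (T : TraceSys) (pl : PBlocks)

/-- a gen-2 diagonal action is a gen-1 diagonal action of the underlying gen-1 morphism -/
lemma isDiagAct_hom {K : CMField} {Φ : Fin 4 → CMType K} {a : K}
    {M : (toyModel2With D T pl).Mor ((toyModel2With D T pl).prod4 K Φ)
      ((toyModel2With D T pl).prod4 K Φ)}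
    (hM : (toyModel2With D T pl).IsDiagAct K Φ a M) :
    (toyModelWith D).IsDiagAct K Φ a M.hom := by
  obtain ⟨e, he1, he2⟩ := hM
  refine ⟨fun i => (e i).hom, he1, fun i k => ?_⟩
  have h := he2 i k
  change map k M.hom.lin ∘ₗ map k ((toyModel2With D T pl).pr4 K Φ i).hom.lin
    = map k ((toyModel2With D T pl).pr4 K Φ i).hom.lin ∘ₗ map k (e i).hom.lin at h
  rw [pr4_hom] at h
  exact h

/-- (Ported verbatim from the HodgeCMPerL package; no docstring in the source.) -/
lemma even_finrank_K (K : CMField) (Ψ : CMType K) : Even (Module.finrank ℚ K) := by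
  rw [← finrank_FK K]
  exact Atom.even_finrank (atomOf K Ψ)

/-- (Ported verbatim from the HodgeCMPerL package; no docstring in the source.) -/
lemma dim_prod4 (K : CMField) (Φ : Fin 4 → CMType K) :
    ((toyModel2With D T pl).prod4 K Φ).dim = 4 * (Module.finrank ℚ K / 2) := by
  change ((((cmObj₂ K (Φ 0)).prod (cmObj₂ K (Φ 1))).prod (cmObj₂ K (Φ 2))).prod (cmObj₂ K (Φ 3))).dim = _
  rw [dim_prod, dim_prod, dim_prod, dim_cmObj₂, dim_cmObj₂, dim_cmObj₂, dim_cmObj₂]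
  ring

/-- (Ported verbatim from the HodgeCMPerL package; no docstring in the source.) -/
lemma two_mul_dim_prod4 (K : CMField) (Φ : Fin 4 → CMType K) :
    2 * ((toyModel2With D T pl).prod4 K Φ).dim = 4 * Module.finrank ℚ K := by
  rw [dim_prod4]
  obtain ⟨m, hm⟩ := even_finrank_K K (Φ 0)
  omega

/-- numerology: `rank_ℚ H¹(A⁴) = 2 (dim A⁴ − 2) + 4` at the gen-2 dimension -/
lemma finrank_eq_k₂ (K : CMField) (Φ : Fin 4 → CMType K) :
    Module.finrank ℚ (PP K Φ).L
      = 2 * ((toyModel2With D T pl).dim ((toyModel2With D T pl).prod4 K Φ) - 2) + 1+1+1+1 := by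
  rw [finrank_L_PP, dim_eq, dim_prod4]
  obtain ⟨m, hm⟩ := even_finrank_K K (Φ 0)
  have : 0 < Module.finrank ℚ K := Module.finrank_pos
  omega

/-! ### M27 -/

/-- **M27 `Fact_deg_diag` holds in `toyModel2With D T pl`, for every trace system `T`.** -/
theorem fact_deg_diag : (toyModel2With D T pl).Fact_deg_diag := by
  intro K Φ a M hM k
  have hlin : M.hom.lin = dμ K Φ a := lin_eq_dμ (isDiagAct_hom D T pl hM)
  by_cases hk : k = 2 * ((toyModel2With D T pl).prod4 K Φ).dim
  · have hk' : Fintype.card (PP K Φ).Idx = k := by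
      rw [hk, two_mul_dim_prod4, card_idx_PP]
    have hmap : map k M.hom.lin = ((Algebra.norm ℚ a) ^ 4) • LinearMap.id := by
      rw [hlin]; exact map_top_dμ K Φ a hk'
    change T.tr _ k ∘ₗ map k M.hom.lin = (Algebra.norm ℚ a ^ 4) • T.tr _ k
    rw [hmap, LinearMap.comp_smul, LinearMap.comp_id]
  · change T.tr _ k ∘ₗ map k M.hom.lin = (Algebra.norm ℚ a ^ 4) • T.tr _ k
    rw [T.degree _ k hk, LinearMap.zero_comp, smul_zero]


/-! ### M28 -/

/-- M28 at a general degree `k₀` with `rank H¹(A⁴) = k₀ + 4`, on gen-1 objects: the twisted trace-form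
star `DQ` is bijective, maps Hodge classes to Hodge classes and is `μ(a)`-equivariant -/
theorem algDuality_PP (K : CMField) (Φ : Fin 4 → CMType K) (k₀ : ℕ)
    (hk : Module.finrank ℚ (PP K Φ).L = k₀+1+1+1+1) :
    Function.Bijective (DQ K Φ k₀ hk) ∧
    ((exteriorHodgeData.hs (PP K Φ) k₀).hodgeClasses ((k₀ / 2 : ℕ) : ℤ)).map (DQ K Φ k₀ hk)
        ≤ (exteriorHodgeData.hs (PP K Φ) (1+1+1+1)).hodgeClasses 2 ∧
    ∀ a : K, map (1+1+1+1) (dμ K Φ (conjRingHomK K a)) ∘ₗ DQ K Φ k₀ hk ∘ₗ map k₀ (dμ K Φ a)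
        = ((Algebra.norm ℚ a) ^ 4) • DQ K Φ k₀ hk := by
  refine ⟨DQ_bijective K Φ k₀ hk, ?_, fun a => DQ_equivariant K Φ k₀ hk a⟩
  have hk2 : k₀ = 2 * (k₀ / 2) := by
    have h4 := finrank_L_PP K Φ
    obtain ⟨m, hm⟩ := even_finrank_K K (Φ 0)
    omega
  rintro _ ⟨w, hw, rfl⟩
  change (PP K Φ).Θ k₀ ((1 : ℂ) ⊗ₜ[ℚ] w) ∈ (PP K Φ).FF k₀ ((k₀ / 2 : ℕ) : ℤ) at hw
  change (PP K Φ).Θ (1+1+1+1) ((1 : ℂ) ⊗ₜ[ℚ] DQ K Φ k₀ hk w) ∈ (PP K Φ).FF (1+1+1+1) 2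
  rw [theta_DQ_e]
  exact Submodule.smul_mem _ _ (T4_mem_FF K Φ k₀ hk _ hk2 _ hw)

set_option maxHeartbeats 800000 in
/-- M28, Hodge part, at the gen-2 dimension -/
theorem fact_algDuality_hodge (K : CMField) (Φ : Fin 4 → CMType K) :
    ((toyModel2With exteriorHodgeData T pl).alg ((toyModel2With exteriorHodgeData T pl).prod4 K Φ)
        ((toyModel2With exteriorHodgeData T pl).dim ((toyModel2With exteriorHodgeData T pl).prod4 K Φ) - 2)).map
      (DQ K Φ _ (finrank_eq_k₂ exteriorHodgeData T pl K Φ))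
      ≤ (toyModel2With exteriorHodgeData T pl).alg ((toyModel2With exteriorHodgeData T pl).prod4 K Φ) 2 := by
  have hhodge := (algDuality_PP K Φ _ (finrank_eq_k₂ exteriorHodgeData T pl K Φ)).2.1
  have hd : ((2 * ((toyModel2With exteriorHodgeData T pl).dim
      ((toyModel2With exteriorHodgeData T pl).prod4 K Φ) - 2)) / 2 : ℕ)
      = (toyModel2With exteriorHodgeData T pl).dim
        ((toyModel2With exteriorHodgeData T pl).prod4 K Φ) - 2 := by omega
  rw [hd] at hhodge
  exact hhodge

set_option maxHeartbeats 800000 in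
/-- M28, equivariance part, at the gen-2 dimension -/
theorem fact_algDuality_equiv (K : CMField) (Φ : Fin 4 → CMType K) (a : K)
    (Ma Mb : (toyModel2With exteriorHodgeData T pl).Mor ((toyModel2With exteriorHodgeData T pl).prod4 K Φ)
      ((toyModel2With exteriorHodgeData T pl).prod4 K Φ))
    (hMa : (toyModel2With exteriorHodgeData T pl).IsDiagAct K Φ a Ma)
    (hMb : (toyModel2With exteriorHodgeData T pl).IsDiagAct K Φ (conjRingHomK K a) Mb) :
    (toyModel2With exteriorHodgeData T pl).pull Mb 4
        ∘ₗ DQ K Φ _ (finrank_eq_k₂ exteriorHodgeData T pl K Φ)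
        ∘ₗ (toyModel2With exteriorHodgeData T pl).pull Ma
          (2 * ((toyModel2With exteriorHodgeData T pl).dim
            ((toyModel2With exteriorHodgeData T pl).prod4 K Φ) - 2))
      = ((Algebra.norm ℚ a) ^ 4) • DQ K Φ _ (finrank_eq_k₂ exteriorHodgeData T pl K Φ) := by
  have ha : Ma.hom.lin = dμ K Φ a := lin_eq_dμ (isDiagAct_hom exteriorHodgeData T pl hMa)
  have hb : Mb.hom.lin = dμ K Φ (conjRingHomK K a) :=
    lin_eq_dμ (isDiagAct_hom exteriorHodgeData T pl hMb)
  have h := (algDuality_PP K Φ _ (finrank_eq_k₂ exteriorHodgeData T pl K Φ)).2.2 a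
  rw [← ha, ← hb] at h
  exact h

set_option maxHeartbeats 800000 in
/-- **M28 `Fact_algDuality` holds in `toyModel2With exteriorHodgeData T pl`.** -/
theorem fact_algDuality : (toyModel2With exteriorHodgeData T pl).Fact_algDuality := by
  intro K Φ
  exact ⟨DQ K Φ _ (finrank_eq_k₂ exteriorHodgeData T pl K Φ),
    (algDuality_PP K Φ _ (finrank_eq_k₂ exteriorHodgeData T pl K Φ)).1,
    fact_algDuality_hodge T pl K Φ,
    fun a Ma Mb hMa hMb => fact_algDuality_equiv T pl K Φ a Ma Mb hMa hMb⟩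

/-! ### Assembly: 27 of 28 -/

/-- **27 of the 28 model axioms hold in `toyModel2With exteriorHodgeData T pl`** for every trace system
and block assignment; the displayed hypothesis is M26 `Fact_gysin_surface`. -/
theorem toyModel2_axioms_of' (h26 : (toyModel2With exteriorHodgeData T pl).Fact_gysin_surface) :
    (toyModel2With exteriorHodgeData T pl).ModelAxioms :=
  toyModel2_axioms_of exteriorHodgeData T pl galoisCMOracle h26
    (fact_deg_diag exteriorHodgeData T pl) (fact_algDuality T pl)

/-- in particular, with zero traces, the generation-2 universe is a model of `ModelAxioms` outright:
a second consistency witness for `ModelAxioms`, on the new object layer -/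
theorem toyModel2_zero_modelAxioms :
    (toyModel2With exteriorHodgeData TraceSys.zero pl).ModelAxioms :=
  toyModel2_axioms_of' TraceSys.zero pl (fun _ _ _ _ => ⟨0, Submodule.zero_mem _, fun _ => rfl⟩)

end

end HodgeCM.ToyG2
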